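import Mathlib
import Summits.MatrixMultiplication.MatrixMultiplication.Theses.HiddenToeplitzCorners
import Summits.MatrixMultiplication.MatrixMultiplication.Cruxes.HiddenCorners.LawOfEnds

/-!
# Certificate degree and the Cayley–Hamilton defect — typed targets of the gen-4 strategist census
# (crux `HiddenCorners`, stmt-MatrixMultiplication-7492)

Companion of `STRATEGY-CENSUS.md` (gen 4) §3, §7, §8.  Classification / disproof-side material (the line registered in this pass,
`Lines/twisted_kronecker.lean`, was withdrawn at birth: its family is a corner on the left).

* `pencil`, `Unital`, `IsSP` — the pencil `T(X) = Σ X_ab • T_ab`, the unital gauge `T(1) = 1`, and "generically nonsingular ∧ singular on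
  `{det X = 0}`" (the body of the crux without structure, size and sparsity).
* `chDefect T X := χ_X(T(X))` — the CAYLEY–HAMILTON DEFECT (census §3.2).  `sp_iff_det_chDefect_eq_zero` (typed): in unital gauge, SP ⟺
  `det χ_X(T(X)) = 0` for all `X`.
* `MinCert T f` — a MINIMAL-DEGREE certificate: a polynomial vector `u(X)` of degree `≤ r − 1` (as `MvPolynomial`s) with
  `T(X) u(X) = det X • f`; `MC T f` — the identity `χ_X(T(X)) f = 0` for all `X`; `minCert_iff_MC` (typed): in unital gauge they coincide.
* `AdjSpanCert`, `PowerCompatible` — "the certificate is a constant image of `vec (adj X)`" (the class (★) of `KroneckerNeutral.md` Lemma (★):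
  corners, Kronecker corners, two-sided cores) and "`T(X)^k f = K vec(X^k)`"; `adjSpan_iff_powerCompatible` (typed); `ConjectureE4` /
  `e4_nonempty` / `ConjectureE4TwoSided` — one-sided E4 is non-empty but every member on record is a corner on the other side (twisted
  Kronecker corners, `Lines/twisted_kronecker.dead.md`); the substantive conjecture is the two-sided one.
* `LawXi c` — the ω-neutral law in Cayley–Hamilton-defect form for UNITAL split-SP pencils; `UnitalGauge` — every split-SP pencil has a
  unital re-gauging of split width `≤ 2d + 3` (PLAN rev 1b item 3, typed); `lawXi_refutes` — PROVED: `UnitalGauge → LawXi c → ¬ HiddenCorners`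
  (through `LawOfEnds.splitNeutralLaw_refutes`).
-/

set_option linter.dupNamespace false
set_option linter.unusedVariables false

namespace Summit.MatrixMultiplication.MatrixMultiplication.Cruxes.HiddenCorners.CertificateDegree

open scoped BigOperators Matrix
open Summit.MatrixMultiplication.MatrixMultiplication.Theses.HiddenToeplitzCorners
open Summit.MatrixMultiplication.MatrixMultiplication.Cruxes.HiddenCorners.LawOfEnds (SplitSP SplitNeutralLaw splitNeutralLaw_refutes)

/-- The pencil `T(X) = Σ_ab X_ab • T_ab` (route convention). -/
noncomputable def pencil {r N : ℕ} (T : Fin r → Fin r → Matrix (Fin N) (Fin N) ℂ)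
    (X : Matrix (Fin r) (Fin r) ℂ) : Matrix (Fin N) (Fin N) ℂ :=
  ∑ a : Fin r, ∑ b : Fin r, X a b • T a b

/-- Unital gauge: `T(1) = 1`. -/
def Unital {r N : ℕ} (T : Fin r → Fin r → Matrix (Fin N) (Fin N) ℂ) : Prop :=
  pencil T 1 = 1

/-- SP without structure: generically nonsingular and singular on every singular `X`. -/
def IsSP {r N : ℕ} (T : Fin r → Fin r → Matrix (Fin N) (Fin N) ℂ) : Prop :=
  (∃ X₀ : Matrix (Fin r) (Fin r) ℂ, (pencil T X₀).det ≠ 0) ∧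
    ∀ X : Matrix (Fin r) (Fin r) ℂ, X.det = 0 → (pencil T X).det = 0

/-- The **Cayley–Hamilton defect** `Ξ(X) := χ_X(T(X))` (census §3.2). -/
noncomputable def chDefect {r N : ℕ} (T : Fin r → Fin r → Matrix (Fin N) (Fin N) ℂ)
    (X : Matrix (Fin r) (Fin r) ℂ) : Matrix (Fin N) (Fin N) ℂ :=
  Polynomial.aeval (pencil T X) X.charpoly

/-- **SP ⟺ the Cayley–Hamilton defect is identically singular** (unital gauge; census §3.2(a)).
`⟹`: `χ_X ∣ χ_{T(X)}`, so every eigenvalue of `X` is one of `T(X)` and each factor `T(X) − λ` of `Ξ(X)` is singular.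
`⟸`: `Res_t(χ_X, χ_{T(X)}) ≡ 0` and `χ_X` is irreducible over `ℂ(X)`, hence `χ_X ∣ χ_{T(X)}` in `ℂ[X][t]`; at `t = 0` this is
`det X ∣ det T(X)`, and `T(1) = 1` gives generic nonsingularity. -/
theorem sp_iff_det_chDefect_eq_zero {r N : ℕ} (T : Fin r → Fin r → Matrix (Fin N) (Fin N) ℂ)
    (hU : Unital T) (hr : 1 ≤ r) :
    IsSP T ↔ ∀ X : Matrix (Fin r) (Fin r) ℂ, (chDefect T X).det = 0 := by
  sorry

/-- Evaluation of a matrix of coordinates at `X`: `evalAt X p = p(X)`. -/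
noncomputable def evalAt {r : ℕ} (X : Matrix (Fin r) (Fin r) ℂ) (p : MvPolynomial (Fin r × Fin r) ℂ) : ℂ :=
  MvPolynomial.eval (fun ab : Fin r × Fin r => X ab.1 ab.2) p

/-- A **minimal-degree certificate** for the output direction `f`: polynomial coordinates `u_i` of total degree `≤ r − 1`, not all
vanishing identically, with `T(X) u(X) = det X • f` for every `X` (census §3.1: the bottom of the certificate-degree ladder
`e ∈ [r−1, N−1]`). -/
def MinCert {r N : ℕ} (T : Fin r → Fin r → Matrix (Fin N) (Fin N) ℂ) (f : Fin N → ℂ) : Prop :=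
  ∃ u : Fin N → MvPolynomial (Fin r × Fin r) ℂ,
    (∀ i, (u i).totalDegree ≤ r - 1) ∧ (∃ X : Matrix (Fin r) (Fin r) ℂ, (fun i => evalAt X (u i)) ≠ 0) ∧
      ∀ X : Matrix (Fin r) (Fin r) ℂ, (pencil T X).mulVec (fun i => evalAt X (u i)) = X.det • f

/-- **(MC)**: `f ≠ 0` is killed by the Cayley–Hamilton defect for every `X`. -/
def MC {r N : ℕ} (T : Fin r → Fin r → Matrix (Fin N) (Fin N) ℂ) (f : Fin N → ℂ) : Prop :=
  f ≠ 0 ∧ ∀ X : Matrix (Fin r) (Fin r) ℂ, (chDefect T X).mulVec f = 0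

/-- **Minimal degree ⟺ (MC)** in unital gauge (census §3.2(b)): restrict `T(X)u(X) = det X • f` to the lines `A + t•1`, where
`T(A + t•1) = T(A) + t•1`, and use that `p(t)•f ∈ (t•1 − C)·ℂ[t]^N ⟺ p(C) f = 0`; conversely (MC) and irreducibility of `χ_X` over
`ℂ(X)` make `ℂ[T(X)] f` an `r`-dimensional cyclic subspace with characteristic polynomial `χ_X`, and Cayley–Hamilton there yields
`u(X) = ± Σ_k c_{r−1−k}(X) T(X)^k f`. -/
theorem minCert_iff_MC {r N : ℕ} (T : Fin r → Fin r → Matrix (Fin N) (Fin N) ℂ) (hU : Unital T) (hr : 1 ≤ r)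
    (f : Fin N → ℂ) : MinCert T f ↔ MC T f := by
  sorry

/-- `vec` of an `r × r` matrix as a function on pairs (row-major, the convention of `KroneckerNeutral`). -/
def vecM {r : ℕ} (M : Matrix (Fin r) (Fin r) ℂ) : Fin r × Fin r → ℂ := fun ab => M ab.1 ab.2

/-- **Adjugate-span certificate** (class (★)): `T(X) · K vec(adj X) = det X • f` with `K ≠ 0`.  By `KroneckerNeutral` Lemma (★) this is
the full bilinear identity `T(X) K vec M = L vec(XM) + L' vec(MX)`; corners, Kronecker corners, Jordan / two-sided cores. -/
def AdjSpanCert {r N : ℕ} (T : Fin r → Fin r → Matrix (Fin N) (Fin N) ℂ) (f : Fin N → ℂ) : Prop :=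
  ∃ K : Matrix (Fin N) (Fin r × Fin r) ℂ, K ≠ 0 ∧
    ∀ X : Matrix (Fin r) (Fin r) ℂ, (pencil T X).mulVec (K.mulVec (vecM X.adjugate)) = X.det • f

/-- **(PC) power-compatibility**: `T(X)^k f = K vec(X^k)` for `k < r`, for one constant `K` (which is then forced by `k = 1`). -/
def PowerCompatible {r N : ℕ} (T : Fin r → Fin r → Matrix (Fin N) (Fin N) ℂ) (f : Fin N → ℂ) : Prop :=
  ∃ K : Matrix (Fin N) (Fin r × Fin r) ℂ,
    ∀ (X : Matrix (Fin r) (Fin r) ℂ) (k : ℕ), k < r → ((pencil T X) ^ k).mulVec f = K.mulVec (vecM (X ^ k))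

/-- **Adjugate-span ⟺ power-compatible** among minimal certificates (census §3.2(c)): `⟸` by `adj X = ± Σ c_{r−1−k}(X) X^k`
(Cayley–Hamilton) and the certificate formula of `minCert_iff_MC`; `⟹` because (★)-pencils satisfy `T(X) K vec M = K'-linear` images of
`vec(XM)`, `vec(MX)`, so `T(X)^k (K vec 1) = K vec(X^k)` by induction. -/
theorem adjSpan_iff_powerCompatible {r N : ℕ} (T : Fin r → Fin r → Matrix (Fin N) (Fin N) ℂ) (hU : Unital T)
    (hr : 1 ≤ r) (f : Fin N → ℂ) (hMC : MC T f) : AdjSpanCert T f ↔ PowerCompatible T f := by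
  sorry

/-- **Conjecture E4** (census §3.2(c)) — "every minimal-degree certificate of a unital linear pencil is adjugate-span", i.e.
(MC) ⟹ (PC), for RIGHT certificates.  **FALSE as typed** (census §3.2(c), §7.2): the twisted Kronecker corner `T(X)F = XF + F₀ Ω Fᵀ X̊ᵀ c dᵀ` on
`ℂ^r ⊗ ℂ^μ` is unital, satisfies (MC) at `f = vec F₀`, and violates (PC) — BUT it is a corner ON THE LEFT (`ℂ^r ⊗ d` is invariant, the transpose has a
Kronecker corner of multiplicity `μ−1`; `Lines/twisted_kronecker.dead.md`).  So the one-sided statement fails for a trivial reason (certificate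
classes are side-dependent) and the typed target `e4_nonempty` below is true but shallow; the substantive statement is `ConjectureE4TwoSided`. -/
def ConjectureE4 : Prop :=
  ∀ (r N : ℕ) (T : Fin r → Fin r → Matrix (Fin N) (Fin N) ℂ) (f : Fin N → ℂ),
    1 ≤ r → Unital T → MC T f → PowerCompatible T f

/-- **One-sided E4 is non-empty** (typed target; census §7.2; shallow — see `ConjectureE4`): some unital pencil has a RIGHT minimal-degree
certificate that is not power-compatible.  Witness: the twisted Kronecker corner at `r = 3, μ = 2, F₀ = [e₁|e₂], Ω = J, c = e₃, d = e₁`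
(nine `6 × 6` matrices with entries in `{0, ±1, ±1/3, ±2/3}`); it is a corner on the left. -/
theorem e4_nonempty : ¬ ConjectureE4 := by
  sorry

/-- The transposed pencil `a b ↦ (T a b)ᵀ` (same variable `X`; same split width; SP iff `T` is). -/
def transposePencil {r N : ℕ} (T : Fin r → Fin r → Matrix (Fin N) (Fin N) ℂ) :
    Fin r → Fin r → Matrix (Fin N) (Fin N) ℂ := fun a b => (T a b)ᵀ

/-- **Conjecture E4, two-sided** (census §3.2(c), §7.2): if a unital pencil has a minimal-degree certificate on the right, then it has an
ADJUGATE-SPAN (power-compatible) minimal-degree certificate on the right OR on the left.  Every EXPLICIT pencil on record satisfies it (twisted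
Kronecker corners: left corner).  **Numerically FALSE** at `(r, N) = (3, 9)`: the validated (MC)-deformations of the Jordan / two-sided core
`X∘M + Λ[X,M]` (kit j026547 + e4sides j0267xx) have a one-dimensional right (MC)-space with PC-defect `0.004–0.015 ≠ 0`, NO constant left
(MC)-vector at all, and their nine coefficient matrices generate all of `M_9` (no invariant subspace: no corner on either side).  No closed form is
known; typed here as the statement a disprover must not assume and a constructor must make explicit. -/
def ConjectureE4TwoSided : Prop :=
  ∀ (r N : ℕ) (T : Fin r → Fin r → Matrix (Fin N) (Fin N) ℂ) (f : Fin N → ℂ),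
    1 ≤ r → Unital T → MC T f →
      (∃ g : Fin N → ℂ, MC T g ∧ PowerCompatible T g) ∨
      (∃ g : Fin N → ℂ, MC (transposePencil T) g ∧ PowerCompatible (transposePencil T) g)

/-- **LAW-Ξ** (census §8 N6): the ω-neutral law for UNITAL split-SP pencils, linear form `r ≤ c · (d + 1)`.  By
`sp_iff_det_chDefect_eq_zero` its hypothesis is "Toeplitz-like of split width `d`, `T(1) = 1`, `det χ_X(T(X)) ≡ 0`" — one identity covering
the census's classes E1–E5 at once. -/
def LawXi (c : ℕ) : Prop :=
  ∀ (r N d : ℕ) (T : Fin r → Fin r → Matrix (Fin N) (Fin N) ℂ), SplitSP r N d T → Unital T → r ≤ c * (d + 1)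

/-- **Unital gauge** (PLAN rev 1b item 3, typed): every split-SP pencil on `M_r` has a unital split-SP re-gauging on the same `M_r`
(`T'(X) := T(X₀)⁻¹ T(X X₀)`, of some size, split width `≤ 2d + 3`).  Typed here as the `Prop` the census uses; proof = displacement rank of a
product with the inverse of a Toeplitz-like matrix. -/
def UnitalGauge : Prop :=
  ∀ (r N d : ℕ) (T : Fin r → Fin r → Matrix (Fin N) (Fin N) ℂ), SplitSP r N d T →
    ∃ (N' : ℕ) (T' : Fin r → Fin r → Matrix (Fin N') (Fin N') ℂ), SplitSP r N' (2 * d + 3) T' ∧ Unital T'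

/-- **The bridge for LAW-Ξ, proved.** Under the unital gauge, any linear law for unital pencils is a polynomial (indeed linear) law for
all split-SP pencils, hence refutes the crux through `LawOfEnds.splitNeutralLaw_refutes`. -/
theorem lawXi_refutes (c : ℕ) (hG : UnitalGauge) (hL : LawXi c) : ¬ HiddenCorners := by
  -- LawXi c + gauge ⇒ every split-SP pencil has r ≤ c (2d + 4) ≤ 4c (d + 1) = SplitNeutralLaw (4c) 1
  have hlaw : SplitNeutralLaw (4 * c) 1 := by
    intro r N d T hT
    obtain ⟨N', T', hT', hU'⟩ := hG r N d T hT
    have h1 : r ≤ c * (2 * d + 3 + 1) := hL r N' (2 * d + 3) T' hT' hU'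
    have h2 : c * (2 * d + 3 + 1) ≤ 4 * c * (d + 1) ^ 1 := by
      have : 2 * d + 3 + 1 ≤ 4 * (d + 1) := by omega
      calc c * (2 * d + 3 + 1) ≤ c * (4 * (d + 1)) := Nat.mul_le_mul_left c this
        _ = 4 * c * (d + 1) ^ 1 := by ring
    exact le_trans h1 h2
  exact splitNeutralLaw_refutes (4 * c) 1 le_rfl hlaw

end Summit.MatrixMultiplication.MatrixMultiplication.Cruxes.HiddenCorners.CertificateDegree
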